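import Summits.ResolutionOfSingularities.ResolutionOfSingularities.Theorems.DescentHironakaBridgeIEResToPrincipalization
import Summits.ResolutionOfSingularities.ResolutionOfSingularities.Theorems.HironakaBridgeERSGlue
import Summits.ResolutionOfSingularities.ResolutionOfSingularities.Theorems.DescentDescentPerfectToAllTrdegLEOne
import Summits.ResolutionOfSingularities.ResolutionOfSingularities.Theorems.WeightedInvariantDescentPerfectToAllEssFiniteTypeOverPerfect

/-!
# Rung B: what the typed candidates give WITHOUT the crux stmt-0549 — the covered classes of ground fields

Cell `res-hironaka`, LADDER-RESOLUTION rung B (OURS; no statement of any manuscript is asserted: the typed Main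
Theorem III `S16Proof.Thm16_14` and the typed §1 claim `HironakaERSPerfect p` enter ONLY as hypotheses). Given
either candidate, the tree proves `PerfectRes p` (`perfectRes_of_thm16_14`, res-type-001;
`perfectRes_of_hironakaERSPerfect`, this seat), and the summit conjunct `ResolutionInChar p` then still needs the
open crux `DescentPerfectToAll`. This file records, as kernel corollaries, the classes of IMPERFECT ground fields
that are nevertheless reached without the crux, by the two descent mechanisms proved in the tree:

* `hasResolution_of_thm16_14_of_essFiniteType` — fields essentially of finite type over a perfect field
  (`hasResolution_of_perfectRes_of_essFiniteType`: spreading out over the perfect field, generic fibre);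
* `hasResolution_of_thm16_14_of_isSeparable_fg` — fields separable algebraic over a finitely generated subfield
  (`hasResolution_of_perfectRes_of_isSeparable_fg`: generic fibre plus separable base change);
* `hasResolution_of_thm16_14_of_trdeg_le_one` — every field of transcendence degree `≤ 1` over `𝔽_p`
  (`hasResolution_of_perfectRes_of_trdeg_le_one`);
and the same three from the §1 candidate (`…_of_hironakaERSPerfect_…`). All dimensions of `X`.
Not reached (the residual = stmt-0549 proper): ground fields separable over no subfield essentially of finite
type over a perfect subfield, e.g. `𝔽_p((t))`.
-/

noncomputable section

set_option linter.dupNamespace false -- mandated namespace of this single-conjunct summit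

open CategoryTheory AlgebraicGeometry
open Literature.AlgebraicGeometry.Resolution
open Literature.AlgebraicGeometry.Hironaka2017.S16Proof

namespace Summit.ResolutionOfSingularities.ResolutionOfSingularities.Theorems

/-! ## From the typed Main Theorem III (`Thm16_14`, a hypothesis) -/

/-- Typed Th. 16.14 (hypothesis) ⇒ resolution over every field essentially of finite type over a perfect field
of characteristic `p`, without the crux stmt-0549. [folklore] -/
theorem hasResolution_of_thm16_14_of_essFiniteType (h16 : Thm16_14.{0}) {p : ℕ} [Fact p.Prime]
    (k₀ k : Type) [Field k₀] [PerfectField k₀] [Field k] [CharP k p] [Algebra k₀ k]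
    [Algebra.EssFiniteType k₀ k] (X : Scheme.{0}) (f : X ⟶ Spec (.of k)) [IsSeparated f]
    [LocallyOfFiniteType f] [QuasiCompact f] [IsReduced X] : Scheme.HasResolution X :=
  hasResolution_of_perfectRes_of_essFiniteType p
    (fun κ _ _ _ Z h a b c d => perfectRes_of_thm16_14 h16 Fact.out κ Z h a b c d)
    k₀ k ‹_› X f ‹_› ‹_› ‹_› ‹_›

/-- Typed Th. 16.14 (hypothesis) ⇒ resolution over every field separable algebraic over a finitely generated
subfield, without the crux stmt-0549. [folklore] -/
theorem hasResolution_of_thm16_14_of_isSeparable_fg (h16 : Thm16_14.{0}) {p : ℕ} [Fact p.Prime]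
    (k : Type) [Field k] [CharP k p] (L₀ : Subfield k) (s₀ : Finset k)
    (hL₀ : L₀ = Subfield.closure (↑s₀ : Set k)) [Algebra.IsSeparable L₀ k]
    (X : Scheme.{0}) (f : X ⟶ Spec (.of k)) [IsSeparated f] [LocallyOfFiniteType f] [QuasiCompact f]
    [IsReduced X] : Scheme.HasResolution X :=
  hasResolution_of_perfectRes_of_isSeparable_fg p
    (fun κ _ _ _ Z h a b c d => perfectRes_of_thm16_14 h16 Fact.out κ Z h a b c d) k L₀ s₀ hL₀ X f

/-- Typed Th. 16.14 (hypothesis) ⇒ resolution over every field of transcendence degree `≤ 1` over `𝔽_p`,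
without the crux stmt-0549. [folklore] -/
theorem hasResolution_of_thm16_14_of_trdeg_le_one (h16 : Thm16_14.{0}) {p : ℕ} [Fact p.Prime]
    (k : Type) [Field k] [CharP k p] (htr : Algebra.trdeg (⊥ : Subfield k) k ≤ 1)
    (X : Scheme.{0}) (f : X ⟶ Spec (.of k)) [IsSeparated f] [LocallyOfFiniteType f] [QuasiCompact f]
    [IsReduced X] : Scheme.HasResolution X :=
  hasResolution_of_perfectRes_of_trdeg_le_one p
    (fun κ _ _ _ Z h a b c d => perfectRes_of_thm16_14 h16 Fact.out κ Z h a b c d) k htr X f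

/-! ## From the typed §1 claim (`HironakaERSPerfect p`, a hypothesis) -/

/-- Typed §1 claim at `p` (hypothesis) ⇒ resolution over every field essentially of finite type over a perfect
field of characteristic `p`, without the crux. [folklore] -/
theorem hasResolution_of_hironakaERSPerfect_of_essFiniteType {p : ℕ} [Fact p.Prime]
    (hH : HironakaERSPerfect p) (k₀ k : Type) [Field k₀] [PerfectField k₀] [Field k] [CharP k p]
    [Algebra k₀ k] [Algebra.EssFiniteType k₀ k] (X : Scheme.{0}) (f : X ⟶ Spec (.of k)) [IsSeparated f]
    [LocallyOfFiniteType f] [QuasiCompact f] [IsReduced X] : Scheme.HasResolution X :=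
  hasResolution_of_perfectRes_of_essFiniteType p
    (fun κ _ _ _ Z h a b c d => perfectRes_of_hironakaERSPerfect hH κ Z h a b c d)
    k₀ k ‹_› X f ‹_› ‹_› ‹_› ‹_›

/-- Typed §1 claim at `p` (hypothesis) ⇒ resolution over every field separable algebraic over a finitely
generated subfield, without the crux. [folklore] -/
theorem hasResolution_of_hironakaERSPerfect_of_isSeparable_fg {p : ℕ} [Fact p.Prime]
    (hH : HironakaERSPerfect p) (k : Type) [Field k] [CharP k p] (L₀ : Subfield k) (s₀ : Finset k)
    (hL₀ : L₀ = Subfield.closure (↑s₀ : Set k)) [Algebra.IsSeparable L₀ k]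
    (X : Scheme.{0}) (f : X ⟶ Spec (.of k)) [IsSeparated f] [LocallyOfFiniteType f] [QuasiCompact f]
    [IsReduced X] : Scheme.HasResolution X :=
  hasResolution_of_perfectRes_of_isSeparable_fg p
    (fun κ _ _ _ Z h a b c d => perfectRes_of_hironakaERSPerfect hH κ Z h a b c d) k L₀ s₀ hL₀ X f

/-- Typed §1 claim at `p` (hypothesis) ⇒ resolution over every field of transcendence degree `≤ 1` over `𝔽_p`,
without the crux. [folklore] -/
theorem hasResolution_of_hironakaERSPerfect_of_trdeg_le_one {p : ℕ} [Fact p.Prime]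
    (hH : HironakaERSPerfect p) (k : Type) [Field k] [CharP k p] (htr : Algebra.trdeg (⊥ : Subfield k) k ≤ 1)
    (X : Scheme.{0}) (f : X ⟶ Spec (.of k)) [IsSeparated f] [LocallyOfFiniteType f] [QuasiCompact f]
    [IsReduced X] : Scheme.HasResolution X :=
  hasResolution_of_perfectRes_of_trdeg_le_one p
    (fun κ _ _ _ Z h a b c d => perfectRes_of_hironakaERSPerfect hH κ Z h a b c d) k htr X f

end Summit.ResolutionOfSingularities.ResolutionOfSingularities.Theorems

end
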